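import Summits.QuantumAdvantage.QuantumAdvantage.Statement
import Summits.QuantumAdvantage.QuantumAdvantage.Theorems.SoloBlindCeiling
import Literature.Computability.Cryptography.ShorAssemblyLeavesProofs
import Literature.Computability.QuantumComplexity.FactoringSearchToDecision
import Literature.Computability.QuantumComplexity.FactoringProofs
import Literature.Computability.QuantumComplexity.FactoringUPFellowsKoblitz
import Literature.Computability.Complexity.PromiseZPPProofs
import Literature.Computability.QuantumComplexity.PromiseBQPSubsetPromisePP
import Literature.Computability.Complexity.UniformDerandomization
import HarnessLib

/-!
# `QuantumAdvantage`: the floor (what implies it), the promise rung (what it implies first),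
# and the derandomisation reading of its ceiling

Companion of `SoloBlindCeiling.lean` (Summit ⇒ `PP ⊄ BPP`, `PSPACE ⊄ BPP`, `EXP ⊄ BPP`; the
relativised and algebrised analogues fail). Everything below is sorry-free over *discharged*
Literature theorems, except §3 which threads the one named fact
`impagliazzoWigderson1998_samplable` (Impagliazzo–Wigderson 1998, van Melkebeek's form) as a
hypothesis.

## §1 Floor — kernel-certified sufficient conditions

* `soloBlind_of_witness`: any `L ∈ BQP ∖ BPP` gives the summit (the statement is a witness form).
* `soloBlind_of_FACT_not_mem_BPP`: **`FACT ∉ BPP → QuantumAdvantage`**, where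
  `FACT = {⟨N, k⟩ : N has a divisor 1 < d ≤ k}`; uses the tree's *proved* Shor theorem
  `FACT_mem_BQP_holds : FACT ∈ BQP` (Shor 1997, §5; `ShorAssemblyLeavesProofs.lean`).
* `soloBlind_of_minFac_hard`: the same floor in search form — if NO probabilistic polynomial-time
  algorithm outputs the least prime factor `Nat.minFac N` with probability `≥ 3/4` on every
  `⟨u, N⟩`, `N ≠ 1`, then the summit holds (Koblitz's binary search against a `BPP` oracle,
  `exists_randAlg_minFac_of_FACT_mem_BPP`, then Shor).

* `soloBlind_floor_not_NP_inter_coNP_subset_BPP`, `…_not_UP_inter_coUP_…`, `…_not_NP_subset_BPP`,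
  `soloBlind_floor_P_ne_NP`: the floor hypothesis `FACT ∉ BPP` also gives `NP ∩ coNP ⊄ BPP`,
  `UP ∩ coUP ⊄ BPP`, `NP ⊄ BPP`, `P ≠ NP` (proved `FACT ∈ NP ∩ coNP`, `FACT ∈ UP ∩ coUP`).

So the summit sits below the classical hardness of factoring: `FACT ∉ BPP ⇒ QuantumAdvantage`,
unconditionally and kernel-checked; the converse is not known, and the floor is a common
strengthening of the summit and of `P ≠ NP` (neither of which is known to imply the other).

## §2 The promise rung — strictly between the summit and `PP ⊄ BPP`

* `soloBlind_promise_witness`: **Summit ⇒ `∃ Q ∈ PromiseBQP, Q ∉ PromiseBPP'`** (`PromiseBPP'` is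
  the textbook promise-`BPP`: a `2/3` gap is demanded on the promise only).
* `soloBlind_not_PP_subset_BPP_of_promise_witness`: **`(∃ Q ∈ PromiseBQP ∖ PromiseBPP') ⇒ PP ⊄ BPP`**
  (by the proved `PromiseBQP ⊆ promiseLift PP`, Adleman–DeMarrais–Huang 1997 Thm. 6.4 in promise
  form, and `promiseLift BPP ⊆ PromiseBPP'`), hence `⇒ P ≠ PP`, `⇒ P ≠ PSPACE`.

The language form (the summit) is thus formally the STRONGER of the two decision forms of
"quantum advantage"; the promise form has a canonical complete problem (additive approximation of
the acceptance probability of an explicit quantum circuit), the language class `BQP` is not known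
to have one, and whether a promise separation yields a separating *language* is open (the same
gap as "`prBPP = prP` versus `BPP = P`", Goldreich 2011, *In a world of P = BPP*, §1).

## §3 Derandomisation reading of the ceiling (one named fact)

* `soloBlind_io_heuristic_derandomisation`: Summit ⇒ (Impagliazzo–Wigderson 1998) every
  `A ∈ BPP` is simulated, for every `ε > 0`, by some `B ∈ DTIME(2^{⌈n^ε⌉})` that agrees with `A`
  with probability `> 1 − m^{−d}` under EVERY polynomial-time samplable length-preserving ensemble,
  for every `d`, for infinitely many lengths `m`.
* `soloBlind_io_uniform_two_thirds`: the uniform-distribution instance (van Melkebeek 2000,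
  eq. (6.2)): agreement on `> 2/3` of `{0,1}^m` for infinitely many `m`, `B ∈ DTIME(2^n)`.

That is: an unconditional proof that ONE uniform family of polynomial-size Clifford+T circuits
decides something outside `BPP` contains an infinitely-often average-case subexponential
derandomisation of ALL of `BPP`.

References: P. W. Shor, SIAM J. Comput. 26 (1997) 1484–1509, §5; N. Koblitz, *Algebraic Aspects
of Cryptography* (1998), Ch. 2 §4.1; L. Adleman, J. DeMarrais, M.-D. Huang, SIAM J. Comput. 26
(1997), Thm. 6.4; O. Goldreich, *On promise problems: a survey*, LNCS 3895 (2006), §1.2, and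
*In a world of P = BPP*, LNCS 6650 (2011), §1; R. Impagliazzo, A. Wigderson, FOCS 1998 = JCSS 63
(2001), Thm. 5 (FOCS numbering); D. van Melkebeek, LNCS 1950 (2000), Thm. 6.2.1, eq. (6.2).
-/

namespace Summit.QuantumAdvantage.QuantumAdvantage.Theorems

open Filter
open Literature.Computability.Complexity Literature.Computability.Complexity.Classes
  Literature.Computability.Complexity.Nondeterministic
  Literature.Computability.Cryptography Literature.Computability.QuantumComplexity
  Literature.Computability.MetaComplexity

/-! ### §1 Floor -/

/-- A single witness language gives the summit (the statement IS the witness form). -/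
theorem soloBlind_of_witness {L : Language Bool} (hQ : L ∈ BQP) (hC : L ∉ BPP) :
    _root_.QuantumAdvantage :=
  ⟨L, hQ, hC⟩

/-- **The Shor floor.** If the decision version of factoring is not in `BPP`, the summit holds —
unconditionally, via the tree's proved `FACT ∈ BQP` (Shor 1997, §5). -/
theorem soloBlind_of_FACT_not_mem_BPP (h : FACT ∉ BPP) : _root_.QuantumAdvantage :=
  soloBlind_of_witness FACT_mem_BQP_holds h

/-- Contrapositive bookkeeping: if the summit fails then factoring (decision form) is in `BPP`. -/
theorem soloBlind_FACT_mem_BPP_of_not (h : ¬ _root_.QuantumAdvantage) : FACT ∈ BPP := by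
  by_contra hF
  exact h (soloBlind_of_FACT_not_mem_BPP hF)

/-- **The Shor floor, search form.** If no probabilistic polynomial-time algorithm (polynomial
time in the pair presentation, exactly polynomial coin budget) outputs the binary numeral of the
least prime factor `Nat.minFac N` with probability `≥ 3/4` on every input `⟨u, N⟩` with `N ≠ 1`,
then the summit holds: `FACT ∈ BPP` would give such an algorithm by Koblitz's bit-by-bit binary
search against the `BPP` oracle (`exists_randAlg_minFac_of_FACT_mem_BPP`). -/
theorem soloBlind_of_minFac_hard
    (h : ¬ ∃ R : RandAlg (List Bool) (List Bool), R.IsPolyTime id (id : List Bool → List Bool) ∧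
      (∃ T : Polynomial ℕ, ∀ n, R.coinLen n = T.eval n) ∧
        ∀ (u : List Bool) (N : ℕ), N ≠ 1 →
          3 / 4 ≤ R.pr id (boolPair u (Computability.encodeNat N)) {Computability.encodeNat N.minFac}) :
    _root_.QuantumAdvantage :=
  soloBlind_of_FACT_not_mem_BPP fun hF => h (exists_randAlg_minFac_of_FACT_mem_BPP hF)

/-- **The floor is above `NP ∩ coNP ⊄ BPP`.** Since `FACT ∈ NP ∩ coNP` (proved in the tree:
divisor certificates and Pratt/AKS certificates, `FACT_mem_NP_inter_coNP_holds`), the Shor-floor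
hypothesis `FACT ∉ BPP` also yields `NP ∩ coNP ⊄ BPP` — a statement not implied by, and not known
to imply, the summit. -/
theorem soloBlind_floor_not_NP_inter_coNP_subset_BPP (h : FACT ∉ BPP) : ¬ (NP ∩ coNP ⊆ BPP) :=
  fun hsub => h (hsub FACT_mem_NP_inter_coNP_holds)

/-- Likewise `FACT ∉ BPP ⇒ UP ∩ coUP ⊄ BPP` (Fellows–Koblitz: `FACT ∈ UP ∩ coUP`, proved). -/
theorem soloBlind_floor_not_UP_inter_coUP_subset_BPP (h : FACT ∉ BPP) : ¬ (UP ∩ coUP ⊆ BPP) :=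
  fun hsub => h (hsub FACT_mem_UP_inter_coUP_holds)

/-- Likewise `FACT ∉ BPP ⇒ NP ⊄ BPP`. -/
theorem soloBlind_floor_not_NP_subset_BPP (h : FACT ∉ BPP) : ¬ (NP ⊆ BPP) :=
  fun hsub => h (hsub FACT_mem_NP_inter_coNP_holds.1)

/-- Likewise `FACT ∉ BPP ⇒ P ≠ NP` (as `P ⊆ BPP`). So the one kernel-certified floor of the summit
is a common strengthening of `QuantumAdvantage` and of `P ≠ NP`. -/
theorem soloBlind_floor_P_ne_NP (h : FACT ∉ BPP) : P ≠ NP := fun he =>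
  h (P_subset_BPP_holds (by rw [he]; exact FACT_mem_NP_inter_coNP_holds.1))

/-! ### §2 The promise rung -/

/-- **Summit ⇒ promise separation.** A witness language `L ∈ BQP ∖ BPP`, read as the promise
problem `⟨L, Lᶜ⟩`, lies in `PromiseBQP` and outside the textbook promise-`BPP`. -/
theorem soloBlind_promise_witness (h : _root_.QuantumAdvantage) :
    ∃ Q : PromiseProblem, Q ∈ PromiseBQP ∧ Q ∉ PromiseBPP' := by
  obtain ⟨L, hQ, hC⟩ := h
  exact ⟨PromiseProblem.ofLanguage L, ofLanguage_mem_PromiseBQP_iff.2 hQ,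
    fun hP => hC (ofLanguage_mem_PromiseBPP'_iff.1 hP)⟩

/-- The same with the strong lift `PromiseBPP = promiseLift BPP` (which is contained in
`PromiseBPP'`). -/
theorem soloBlind_promise_witness_lift (h : _root_.QuantumAdvantage) :
    ∃ Q : PromiseProblem, Q ∈ PromiseBQP ∧ Q ∉ PromiseBPP := by
  obtain ⟨Q, hQ, hQ'⟩ := soloBlind_promise_witness h
  exact ⟨Q, hQ, fun hP => hQ' (PromiseBPP_subset_PromiseBPP'_holds hP)⟩

/-- **Promise separation ⇒ `PP ⊄ BPP`.** If `PP ⊆ BPP` then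
`PromiseBQP ⊆ promiseLift PP ⊆ promiseLift BPP = PromiseBPP ⊆ PromiseBPP'`. -/
theorem soloBlind_not_PP_subset_BPP_of_promise_witness
    (h : ∃ Q : PromiseProblem, Q ∈ PromiseBQP ∧ Q ∉ PromiseBPP') : ¬ (PP ⊆ BPP) := by
  rintro hPP
  obtain ⟨Q, hQ, hQ'⟩ := h
  have h1 : Q ∈ promiseLift PP := PromiseBQP_subset_promiseLift_PP hQ
  have h2 : Q ∈ PromiseBPP := promiseLift_mono hPP h1
  exact hQ' (PromiseBPP_subset_PromiseBPP'_holds h2)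

/-- Promise separation ⇒ `P ≠ PP` (the tree's `P_ne_PP_of_promise_witness`, restated). -/
theorem soloBlind_P_ne_PP_of_promise_witness
    (h : ∃ Q : PromiseProblem, Q ∈ PromiseBQP ∧ Q ∉ PromiseBPP') : P ≠ PP := by
  obtain ⟨Q, hQ, hQ'⟩ := h
  exact P_ne_PP_of_promise_witness hQ hQ'

/-- Promise separation ⇒ `P ≠ PSPACE` (if `P = PSPACE` then `PP ⊆ PSPACE = P ⊆ BPP`). -/
theorem soloBlind_P_ne_PSPACE_of_promise_witness
    (h : ∃ Q : PromiseProblem, Q ∈ PromiseBQP ∧ Q ∉ PromiseBPP') : P ≠ PSPACE := fun he =>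
  soloBlind_not_PP_subset_BPP_of_promise_witness h
    (fun _ hL => P_subset_BPP_holds (he.symm ▸ PP_subset_PSPACE_holds hL))

/-! ### §3 Derandomisation reading of the ceiling -/

/-- **Summit ⇒ i.o. heuristic subexponential derandomisation of `BPP` against all samplable
ensembles** (Impagliazzo–Wigderson 1998 / van Melkebeek Thm. 6.2.1, threaded as the named fact
`impagliazzoWigderson1998_samplable`; the summit supplies its hypothesis `BPP ≠ EXP` by
`soloBlind_BPP_ne_EXP`). -/
theorem soloBlind_io_heuristic_derandomisation (h : _root_.QuantumAdvantage)
    (hIW : impagliazzoWigderson1998_samplable) :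
    ∀ A ∈ BPP, ∀ ε : ℝ, 0 < ε →
      ∃ B ∈ DTIME (fun n => 2 ^ ⌈(n : ℝ) ^ ε⌉₊),
        ∀ (d : ℕ) (D : Ensemble), D.IsPolySamplable →
          (∀ m, ∀ x ∈ (D m).support, x.length = m) →
            ∃ᶠ m : ℕ in atTop, 1 - 1 / (m : ℝ) ^ d < D.prob m {x | x ∈ A ↔ x ∈ B} :=
  hIW (soloBlind_BPP_ne_EXP h)

/-- **Summit ⇒ every `BPP` language agrees with some `DTIME(2^n)` language on more than `2/3` of
`{0,1}^m` for infinitely many `m`** (van Melkebeek 2000, eq. (6.2), under the same named fact). -/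
theorem soloBlind_io_uniform_two_thirds (h : _root_.QuantumAdvantage)
    (hIW : impagliazzoWigderson1998_samplable) {A : Language Bool} (hA : A ∈ BPP) :
    ∃ B ∈ DTIME (fun n => 2 ^ n),
      ∃ᶠ m : ℕ in atTop, (2 : ℝ) / 3 < uniformProb m {x | x ∈ A ↔ x ∈ B} :=
  impagliazzoWigderson1998_uniform_two_thirds hIW (soloBlind_BPP_ne_EXP h) hA

end Summit.QuantumAdvantage.QuantumAdvantage.Theorems
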